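import Mathlib
import Summits.MatrixMultiplication.MatrixMultiplication.Theorems.SnSubsetDichotomyPolynomialSlackCylinderMarginals

/-!
# Forced collisions: `n·Σ_j m_{ST}(i,j)·m_{TU}(j,k) ≥ |T|²·m_{US}(k,i)`

Crux `Summit.MatrixMultiplication.MatrixMultiplication.Theses.SnSubsetDichotomy.PolynomialSlack`
(item `stmt-MatrixMultiplication-8306`), level-one programme, lead c7 (two dense quotients).

For `S, T, U ⊆ S_n` write `c_X(v,q) = #{x ∈ X : x q = v}` for the marginal counts and
`m_{XY}(i,j) = #{(x,y) ∈ X × Y : y j = x i}` for the pair marginals. The pair marginals factor over the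
common value (`pairMarginal_eq_sum_mul`), so `Σ_j m_{ST}(i,j)·m_{TU}(j,k) = Σ_j Σ_{v,w} c_S(v,i)c_T(v,j)c_T(w,j)c_U(w,k)`;
keeping the diagonal `w = v` and Cauchy–Schwarz `n·Σ_j c_T(v,j)² ≥ (Σ_j c_T(v,j))² = |T|²`
(`sum_marginal_row`) gives the forced-collision inequality `forced_collision`.
-/

namespace Summit.MatrixMultiplication.MatrixMultiplication.Theorems.PolynomialSlack

set_option linter.dupNamespace false

open scoped BigOperators

/-- Abstract form of the forced-collision count: for nonnegative profiles `cS, cU : Fin n → ℝ` and a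
nonnegative kernel `cT` with constant row sums `τ`,
`τ²·Σ_v cU(v)cS(v) ≤ n·Σ_j (Σ_v cS(v)cT(v,j))·(Σ_w cT(w,j)cU(w))`
(drop the off-diagonal terms `w ≠ v`, then Cauchy–Schwarz in `j`). [folklore] -/
private theorem forced_collision_aux {n : ℕ} (cS cU : Fin n → ℝ) (cT : Fin n → Fin n → ℝ) (τ : ℝ)
    (hS : ∀ v, 0 ≤ cS v) (hU : ∀ w, 0 ≤ cU w) (hT : ∀ v j, 0 ≤ cT v j)
    (hrow : ∀ v, ∑ j : Fin n, cT v j = τ) :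
    τ ^ 2 * ∑ v : Fin n, cU v * cS v ≤
      n * ∑ j : Fin n, (∑ v : Fin n, cS v * cT v j) * ∑ w : Fin n, cT w j * cU w := by
  calc τ ^ 2 * ∑ v : Fin n, cU v * cS v
      = ∑ v : Fin n, cS v * cU v * (∑ j : Fin n, cT v j) ^ 2 := by
        rw [Finset.mul_sum]
        refine Finset.sum_congr rfl fun v _ => ?_
        rw [hrow v]; ring
    _ ≤ ∑ v : Fin n, cS v * cU v * (n * ∑ j : Fin n, cT v j ^ 2) := by
        refine Finset.sum_le_sum fun v _ => mul_le_mul_of_nonneg_left ?_ (mul_nonneg (hS v) (hU v))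
        have h := sq_sum_le_card_mul_sum_sq (s := (Finset.univ : Finset (Fin n))) (f := cT v)
        rwa [Finset.card_univ, Fintype.card_fin] at h
    _ = n * ∑ j : Fin n, ∑ v : Fin n, cS v * cT v j * (cT v j * cU v) := by
        rw [Finset.sum_comm]
        simp only [Finset.mul_sum]
        refine Finset.sum_congr rfl fun v _ => Finset.sum_congr rfl fun j _ => ?_
        ring
    _ ≤ n * ∑ j : Fin n, ∑ v : Fin n, cS v * cT v j * ∑ w : Fin n, cT w j * cU w := by
        refine mul_le_mul_of_nonneg_left (Finset.sum_le_sum fun j _ => Finset.sum_le_sum fun v _ =>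
          mul_le_mul_of_nonneg_left ?_ (mul_nonneg (hS v) (hT v j))) (Nat.cast_nonneg n)
        exact Finset.single_le_sum (f := fun w => cT w j * cU w)
          (fun w _ => mul_nonneg (hT w j) (hU w)) (Finset.mem_univ v)
    _ = n * ∑ j : Fin n, (∑ v : Fin n, cS v * cT v j) * ∑ w : Fin n, cT w j * cU w := by
        simp_rw [Finset.sum_mul]

/-- **Forced collisions.** For `S, T, U ⊆ S_n` and positions `i, k`, writing
`m_{ST}(i,j) = #{(s,t) : t j = s i}`, `m_{TU}(j,k) = #{(t,u) : u k = t j}`, `m_{US}(k,i) = #{(u,s) : s i = u k}`: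
`|T|²·m_{US}(k,i) ≤ n·Σ_j m_{ST}(i,j)·m_{TU}(j,k)`. Proof: factor the three marginals over the common value
(`pairMarginal_eq_sum_mul`), keep the diagonal `v = w` of `Σ_j m_{ST} m_{TU} = Σ_{v,w} c_S(v,i) c_U(w,k) Σ_j c_T(v,j)c_T(w,j)`
and use Cauchy–Schwarz `Σ_j c_T(v,j)² ≥ (Σ_j c_T(v,j))²/n = |T|²/n` (`sum_marginal_row`). [folklore] -/
theorem forced_collision {n : ℕ} (S T U : Finset (Equiv.Perm (Fin n))) (i k : Fin n) :
    (T.card : ℝ) ^ 2 * (((U ×ˢ S).filter fun us => us.2 i = us.1 k).card : ℝ) ≤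
      n * ∑ j : Fin n, (((S ×ˢ T).filter fun st => st.2 j = st.1 i).card : ℝ) *
        (((T ×ˢ U).filter fun tu => tu.2 k = tu.1 j).card : ℝ) := by
  have hS : ∀ v : Fin n, 0 ≤ ((S.filter fun x => x i = v).card : ℝ) := fun _ => by positivity
  have hU : ∀ w : Fin n, 0 ≤ ((U.filter fun x => x k = w).card : ℝ) := fun _ => by positivity
  have hT : ∀ v j : Fin n, 0 ≤ ((T.filter fun y => y j = v).card : ℝ) := fun _ _ => by positivity
  have hrow : ∀ v : Fin n, ∑ j : Fin n, ((T.filter fun y => y j = v).card : ℝ) = (T.card : ℝ) :=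
    fun v => sum_marginal_row T v
  have h := forced_collision_aux _ _ _ _ hS hU hT hrow
  rw [pairMarginal_eq_sum_mul U S k i]
  simp_rw [pairMarginal_eq_sum_mul S T i, pairMarginal_eq_sum_mul T U _ k]
  exact h

end Summit.MatrixMultiplication.MatrixMultiplication.Theorems.PolynomialSlack
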